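import Mathlib
import HarnessLib
import Literature.Analysis.FluidPDE.TypeIAncientMild
import Summits.NavierStokesRegularity.NavierStokesRegularity.Theses.SymmetryModuliCount

/-!
# Route SymmetryModuliCount — crux `ForcedSymmetry` (stmt-NavierStokesRegularity-4052), line `blow-down-census`,
stub `stub_lerayRateEnergy`

The first step of the blow-down line is the far-past energy LEDGER at Leray's rate: for `u ∈ A_C`
(`IsTypeIAncientMild C u`) the energy in every ball grows at most linearly in the radius,
`∫_{B_r(x₀)} ‖u(t)‖² ≤ K r`, uniformly in `t < 0` and in the centre `x₀`, with a constant `K` that may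
depend on `u`.  This is a corollary of the sibling route item `FarPastLedger`
(stmt-NavierStokesRegularity-14060), which provides the stronger UNIFORM constant `K = K(C)`.

* `stub_lerayRateEnergy_of_farPastLedger` : the conditional glue `FarPastLedger → stub`, sorry-free,
  conditional on the route decl `FarPastLedger` only (a hypothesis).
-/

noncomputable section

-- `Summit.NavierStokesRegularity.NavierStokesRegularity` repeats a component by design (summit = sub-problem).
set_option linter.dupNamespace false

namespace Summit.NavierStokesRegularity.NavierStokesRegularity.Theorems.SymmetryModuliCountForcedSymmetry

open MeasureTheory Set Metric
open Literature.Analysis.FluidPDE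
open Summit.NavierStokesRegularity.NavierStokesRegularity.Theses.SymmetryModuliCount (FarPastLedger)

/-- **Stub 1 of line `blow-down-census`, conditional form.**  The route item `FarPastLedger`
(`∀ C, ∃ K, ∀ u ∈ A_C, ∀ t < 0, ∀ x₀ R, 0 < R → ∫_{B_R(x₀)} ‖u(t)‖² ≤ K R`, uniform `K = K(C)`) implies the
registered stub `stub_lerayRateEnergy` (the same bound with `K` allowed to depend on `u`): swap the
quantifiers `∃ K ∀ u ⇒ ∀ u ∃ K`. [folklore] -/
theorem stub_lerayRateEnergy_of_farPastLedger (hL : FarPastLedger) :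
    ∀ (C : ℝ) (u : ℝ → EuclideanSpace ℝ (Fin 3) → EuclideanSpace ℝ (Fin 3)),
      IsTypeIAncientMild C u →
      ∃ K : ℝ, ∀ t < 0, ∀ (x₀ : EuclideanSpace ℝ (Fin 3)) (r : ℝ), 0 < r →
        ∫ x in ball x₀ r, ‖u t x‖ ^ 2 ≤ K * r := by
  intro C u hu
  obtain ⟨K, hK⟩ := hL C
  exact ⟨K, fun t ht x₀ r hr => hK u hu t ht x₀ r hr⟩

end Summit.NavierStokesRegularity.NavierStokesRegularity.Theorems.SymmetryModuliCountForcedSymmetry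

end
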